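import Summits.QuantumFields.BalabanUV.Beta.FP.SliceProjectorEntries

/-!
# `BalabanUV.Beta.FP.SliceProjectorSymbol` — road «FP» (binder row D1), organisation γ, row GAMMA-3 (c, assembly): **THE FINE-KERNEL SYMBOL
# `S_{ab}(k) = Σ_{ll′} e^{i k_l·a}·A_{ll′}(k)·e^{−i k_{l′}·b}` OF THE SLICE CO-PROJECTOR `1 − Π`** — its honest product form
# `S = yInv·F_a·F̄_b` off the zero set, its `2π`-PERIODICITY ACROSS THE STRIP SIDES (alias re-indexing), its holomorphy on the strip, and
# **the conditional END: an n-uniform bound `‖S_{ab}‖ ≤ M` on `Strip D κ_Y` ⟹ `StripRegular S_{ab} κ_Y M` ⟹ `‖latticeKernel S_{ab} X‖ ≤ M·e^{−κ_Y‖X‖∞}`**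
# (the bound itself = the ONE alias-sum estimate of the row, `HOME/…/leaf-06/g8/GAMMA3-C-DESIGN.md` §3, next file)

HONEST FRAMING (cell contract, verbatim): «discharging `BetaPertH` makes Bałaban's UV stability UNCONDITIONAL — a real constructive-QFT
result; it is NOT the continuum limit and NOT the Clay problem.»  HONEST DEPENDENCY (verbatim): «continuum YM on T⁴ ⇐ BetaPertH ∧ nine
spine estimates (0/9 proved); BetaPertH ⇐ (D1) ∧ (D4) ∧ CAP+tail; G-an2-4 gates asym, D1 and NE2/3/4.»  THIS MODULE DISCHARGES NOTHING of
D1 ∕ BetaPertH: [folklore] assembly over parts (a)(b) (`yInv_periodic_side`, `Aent_eq_honest`, `differentiableAt_Aent`, `differentiableAt_qa`), gan24's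
`AliasDecimate.aliasSym_periodic`∕`aliasPt_update`∕`periodic_update_nat`, `Beta.FibreInverseDecay.cphase_periodic`, and `B4ContourShift.latticeKernel_decay`
BY NAME.  [our object] data defs `S`, `Ga`, `Gb`, `Fa`, `Fb`; no `def … : Prop` (the n-uniform bound enters the END as an explicit real
inequality hypothesis, displayed); nothing is cited; 0 sorry.  NOT summit progress; NOT hbook, NOT D1, NOT BetaPertH, NOT continuum, NOT Clay.

ABSOLUTE RULE (cell, verbatim): «No internally-minted statement may enter as a cited fact. Every hypothesis is either kernel-proved in this
package or a verbatim quotation of a PUBLISHED theorem with page reference. The manuscript(s) under audit are NOT citable for their own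
disputed steps — they are the thing under adjudication; programme-internal (2001/route/tribunal) claims are never citable.»

READING: `(1−Π)(nX + a, nY + b) = n^{−D}·latticeKernel (S n a b) (X − Y)` (alias form of `Δ⁻¹Q′ᵀMid⁻¹Q′Δ⁻¹`, block-mean `Q′`; the operator-level
identification is part (d)).  CONTENT (`D = d+1`):
* §1 `S`, `DeltaXi_shift_eq` (`Δ^ξ(k+2πl) = n²·Δ¹(k_l)`), `Fa`∕`Fb`, **`S_eq_honest`** (`Δ^ξ(k) ≠ 0 ⟹ S = yInv·Fa·Fb`), `Ga`∕`Gb`, `gsum_add_two_pi`,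
  `Ga_periodic`∕`Gb_periodic`, `Fa_eq_aliasSym`∕`Fb_eq_aliasSym`, **`Fa_periodic`∕`Fb_periodic`** (every complex `k`).
* §2 `differentiableAt_cphase_aliasPt`, **`differentiableAt_S`** (strip points).
* §3 **`S_periodic_side`**.
* §4 **`stripRegular_S_of_bound`**, **`norm_latticeKernel_S_le_of_bound`** — the conditional END.
Unit `b2b-balaban-beta-d1-formalise-leaf-06` (gen 8), organisation γ (R-FP-25), row GAMMA-3 (c); parts (a) p244337 ✓, (b) p244695.
-/

noncomputable section

namespace Summit.QuantumFields.BalabanUV.Beta.FP.SliceProjectorSymbol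

open Complex Set Finset
open scoped BigOperators Real
open Literature.MathematicalPhysics.QuantumFieldTheory.Balaban1983to89
open B4Strip (Strip ofRealVec reVec DeltaXi Delta1 S1 Sxi shift)
open B4StripCauchy (Fat rOf rOf_pos rOf_le d_mul_rOf_sq_le)
open B5Strip145 (Ncal)
open B5Strip145Analytic (tr tr_def tr_im tr_re_self tr_apply_self re_DeltaXi_pos_of_edge kappa_small S1_add_two_pi)
open B5Strip145Decay (differentiableAt_insertNth tr_insertNth_left insertNth_left_mem)
open B4ContourShift (BZ StripRegular latticeKernel supNorm latticeKernel_decay insertNth_mem_Strip openRect_subset_closedRect)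
open Beta.FibreInverseDecay (cphase cphase_periodic continuous_cphase)
open Summit.QuantumFields.BalabanUV.Beta.GAN24.FibreSymbols (gsum)
open Summit.QuantumFields.BalabanUV.Beta.GAN24.AliasDecimate (aliasPt aliasSym aliasSym_periodic)
open Summit.QuantumFields.BalabanUV.Beta.FP.CoarseCovarianceStripAliasWeights (aliasPt_apply')
open Summit.QuantumFields.BalabanUV.Beta.FP.SliceProjectorMidInv
open Summit.QuantumFields.BalabanUV.Beta.FP.SliceProjectorEntries

variable {d : ℕ}

/-! ## §1 The symbol, its honest product form, and the periodicity of the factors -/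

/-- [our object] **THE FINE-KERNEL SYMBOL OF `1 − Π` AT INTRA-BLOCK OFFSETS `a` (row) AND `b` (column)**:
`S n a b k := Σ_l Σ_l′ e^{i k_l·a} · A_{ll′}(k) · e^{−i k_{l′}·b}`. -/
def S (n : ℕ) [NeZero n] (a b : Fin (d + 1) → ℤ) (k : Fin (d + 1) → ℂ) : ℂ :=
  ∑ l : Fin (d + 1) → Fin n, ∑ l' : Fin (d + 1) → Fin n, cphase a (aliasPt n l k) * Aent n l l' k * cphase (-b) (aliasPt n l' k)

/-- [folklore] the shifted symbol through the alias momentum: `Δ^ξ(k + 2πl) = n²·Δ¹(k_l)` (`S_ξ(z) = n²·S₁(z/n)` coordinatewise). -/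
theorem DeltaXi_shift_eq (n : ℕ) [NeZero n] (l : Fin (d + 1) → Fin n) (k : Fin (d + 1) → ℂ) :
    DeltaXi n 0 (shift n l k) = (n : ℂ) ^ 2 * Delta1 0 (aliasPt n l k) := by
  simp only [DeltaXi, Delta1, Complex.ofReal_zero, add_zero, Finset.mul_sum]
  refine Finset.sum_congr rfl fun μ _ => ?_
  simp only [Sxi, S1, shift, aliasPt_apply']

/-- [our object] the row factor `Fa n a k := Σ_l e^{i k_l·a}·qa_l/Δ^ξ(k+2πl)`. -/
def Fa (n : ℕ) [NeZero n] (a : Fin (d + 1) → ℤ) (k : Fin (d + 1) → ℂ) : ℂ :=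
  ∑ l : Fin (d + 1) → Fin n, cphase a (aliasPt n l k) * (qa n l k / DeltaXi n 0 (shift n l k))

/-- [our object] the column factor `Fb n b k := Σ_l′ e^{−i k_{l′}·b}·qb_{l′}/Δ^ξ(k+2πl′)`. -/
def Fb (n : ℕ) [NeZero n] (b : Fin (d + 1) → ℤ) (k : Fin (d + 1) → ℂ) : ℂ :=
  ∑ l : Fin (d + 1) → Fin n, cphase (-b) (aliasPt n l k) * (qb n l k / DeltaXi n 0 (shift n l k))

/-- [our object] **THE HONEST PRODUCT FORM**: off the zero set of `Δ^ξ(k)`, `S = yInv·Fa·Fb` — the symbol of `Δ⁻¹Q′ᵀ·Mid⁻¹·Q′Δ⁻¹` literally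
(row alias sum × `Mid⁻¹` × column alias sum). -/
theorem S_eq_honest (n : ℕ) [NeZero n] (a b : Fin (d + 1) → ℤ) {k : Fin (d + 1) → ℂ} (h0 : DeltaXi n 0 k ≠ 0) :
    S n a b k = yInv n k * Fa n a k * Fb n b k := by
  unfold S Fa Fb
  simp_rw [Aent_eq_honest n _ _ h0]
  rw [mul_assoc, Finset.sum_mul_sum, Finset.mul_sum]
  refine Finset.sum_congr rfl fun l _ => ?_
  rw [Finset.mul_sum]
  refine Finset.sum_congr rfl fun l' _ => ?_
  ring

/-- [our object] the periodic single-momentum weight of the row factor: `Ga n q := (n^{−D}·Π_i gsum (q i) n)/(n²·Δ¹(q))`. -/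
def Ga (n : ℕ) (q : Fin (d + 1) → ℂ) : ℂ := (((n : ℂ) ^ (d + 1))⁻¹ * ∏ i, gsum (q i) n) / ((n : ℂ) ^ 2 * Delta1 0 q)

/-- [our object] the periodic single-momentum weight of the column factor: `Gb n q := (n^{−D}·Π_i gsum (−q i) n)/(n²·Δ¹(q))`. -/
def Gb (n : ℕ) (q : Fin (d + 1) → ℂ) : ℂ := (((n : ℂ) ^ (d + 1))⁻¹ * ∏ i, gsum (-q i) n) / ((n : ℂ) ^ 2 * Delta1 0 q)

/-- [folklore] `gsum` is `2π`-periodic: `gsum (z + 2π) n = gsum z n`. -/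
theorem gsum_add_two_pi (z : ℂ) (n : ℕ) : gsum (z + 2 * π) n = gsum z n := by
  unfold gsum
  refine Finset.sum_congr rfl fun t _ => ?_
  have h : cexp (I * (2 * π) * t) = 1 := by
    have := Complex.exp_nat_mul_two_pi_mul_I t
    rw [← this]; congr 1; ring
  rw [show I * (z + 2 * π) * t = I * z * t + I * (2 * π) * t by ring, Complex.exp_add, h, mul_one]

/-- [folklore] `gsum (−(z + 2π)) n = gsum (−z) n`. -/
theorem gsum_neg_add_two_pi (z : ℂ) (n : ℕ) : gsum (-(z + 2 * π)) n = gsum (-z) n := by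
  unfold gsum
  refine Finset.sum_congr rfl fun t _ => ?_
  have h : cexp (-(I * (2 * π) * t)) = 1 := by
    rw [Complex.exp_neg]
    have := Complex.exp_nat_mul_two_pi_mul_I t
    rw [show I * (2 * (π : ℂ)) * t = t * (2 * π * I) by ring, this, inv_one]
  rw [show I * -(z + 2 * π) * t = I * -z * t + -(I * (2 * π) * t) by ring, Complex.exp_add, h, mul_one]

/-- [folklore] `Δ¹` is `2π`-periodic in each coordinate. -/
theorem Delta1_periodic (i : Fin (d + 1)) (q : Fin (d + 1) → ℂ) : Delta1 0 (Function.update q i (q i + 2 * π)) = Delta1 0 q := by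
  simp only [Delta1, Complex.ofReal_zero, add_zero]
  refine Finset.sum_congr rfl fun μ _ => ?_
  by_cases h : μ = i
  · subst h; rw [Function.update_self]; exact S1_add_two_pi (q μ)
  · rw [Function.update_of_ne h]

/-- [folklore] `Ga` is `2π`-periodic in each coordinate. -/
theorem Ga_periodic (n : ℕ) (i : Fin (d + 1)) (q : Fin (d + 1) → ℂ) : Ga n (Function.update q i (q i + 2 * π)) = Ga n q := by
  unfold Ga
  rw [Delta1_periodic]
  congr 2
  refine Finset.prod_congr rfl fun j _ => ?_
  by_cases h : j = i
  · subst h; rw [Function.update_self]; exact gsum_add_two_pi (q j) n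
  · rw [Function.update_of_ne h]

/-- [folklore] `Gb` is `2π`-periodic in each coordinate. -/
theorem Gb_periodic (n : ℕ) (i : Fin (d + 1)) (q : Fin (d + 1) → ℂ) : Gb n (Function.update q i (q i + 2 * π)) = Gb n q := by
  unfold Gb
  rw [Delta1_periodic]
  congr 2
  refine Finset.prod_congr rfl fun j _ => ?_
  by_cases h : j = i
  · subst h; rw [Function.update_self]; exact gsum_neg_add_two_pi (q j) n
  · rw [Function.update_of_ne h]

/-- [folklore] the row factor IS gan24's aliased symbol of `Ga` (up to `n^{D}`): `Fa n a k = n^{D}·aliasSym n a (Ga n) k`. -/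
theorem Fa_eq_aliasSym (n : ℕ) [NeZero n] (a : Fin (d + 1) → ℤ) (k : Fin (d + 1) → ℂ) :
    Fa n a k = (n : ℂ) ^ (d + 1) * aliasSym n a (Ga n) k := by
  have hn : (n : ℂ) ≠ 0 := Nat.cast_ne_zero.mpr (NeZero.ne n)
  unfold Fa aliasSym
  rw [← mul_assoc, mul_inv_cancel₀ (pow_ne_zero _ hn), one_mul]
  refine Finset.sum_congr rfl fun l _ => ?_
  rw [DeltaXi_shift_eq, Ga, qa]

/-- [folklore] the column factor likewise: `Fb n b k = n^{D}·aliasSym n (−b) (Gb n) k`. -/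
theorem Fb_eq_aliasSym (n : ℕ) [NeZero n] (b : Fin (d + 1) → ℤ) (k : Fin (d + 1) → ℂ) :
    Fb n b k = (n : ℂ) ^ (d + 1) * aliasSym n (-b) (Gb n) k := by
  have hn : (n : ℂ) ≠ 0 := Nat.cast_ne_zero.mpr (NeZero.ne n)
  unfold Fb aliasSym
  rw [← mul_assoc, mul_inv_cancel₀ (pow_ne_zero _ hn), one_mul]
  refine Finset.sum_congr rfl fun l _ => ?_
  rw [DeltaXi_shift_eq, Gb, qb]

/-- [our object] **THE ROW FACTOR IS `2π`-PERIODIC IN EACH COARSE COORDINATE** (every complex `k`; alias re-indexing, `aliasSym_periodic` BY NAME). -/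
theorem Fa_periodic (n : ℕ) [NeZero n] (a : Fin (d + 1) → ℤ) (i : Fin (d + 1)) (k : Fin (d + 1) → ℂ) :
    Fa n a (Function.update k i (k i + 2 * π)) = Fa n a k := by
  rw [Fa_eq_aliasSym, Fa_eq_aliasSym, aliasSym_periodic n (Ga_periodic n) a i k]

/-- [our object] the column factor is `2π`-periodic in each coarse coordinate. -/
theorem Fb_periodic (n : ℕ) [NeZero n] (b : Fin (d + 1) → ℤ) (i : Fin (d + 1)) (k : Fin (d + 1) → ℂ) :
    Fb n b (Function.update k i (k i + 2 * π)) = Fb n b k := by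
  rw [Fb_eq_aliasSym, Fb_eq_aliasSym, aliasSym_periodic n (Gb_periodic n) (-b) i k]

/-! ## §2 Holomorphy on the strip -/

/-- [folklore] the character at an alias momentum is an entire function of the coarse momentum. -/
theorem differentiableAt_cphase_aliasPt (n : ℕ) (a : Fin (d + 1) → ℤ) (l : Fin (d + 1) → Fin n) (k : Fin (d + 1) → ℂ) :
    DifferentiableAt ℂ (fun q : Fin (d + 1) → ℂ => cphase a (aliasPt n l q)) k := by
  unfold cphase
  refine ((DifferentiableAt.fun_sum fun μ _ => ?_).const_mul I).cexp
  exact (differentiableAt_aliasPt_apply n l μ k).mul_const _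

/-- [our object] **`S n a b` IS HOLOMORPHIC (JOINTLY) AT EVERY POINT OF THE STRIP `Strip D κ_Y`.** -/
theorem differentiableAt_S (n : ℕ) [NeZero n] (a b : Fin (d + 1) → ℤ) {k : Fin (d + 1) → ℂ} (hk : k ∈ Strip (d + 1) (kapY (d + 1))) :
    DifferentiableAt ℂ (S n a b) k := by
  unfold S
  refine DifferentiableAt.fun_sum fun l _ => DifferentiableAt.fun_sum fun l' _ => ?_
  exact ((differentiableAt_cphase_aliasPt n a l k).mul (differentiableAt_Aent n l l' hk)).mul (differentiableAt_cphase_aliasPt n (-b) l' k)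

/-! ## §3 Periodicity across the strip sides -/

/-- [our object] **`S n a b` IS `2π`-PERIODIC ACROSS THE STRIP SIDES**: for `k ∈ Strip D κ_Y` with `Re k_μ = −π`, `S(k + 2πe_μ) = S(k)`
(there `Δ^ξ ≠ 0` at both points, so the honest product form applies; its three factors are periodic). -/
theorem S_periodic_side (n : ℕ) [NeZero n] (a b : Fin (d + 1) → ℤ) {k : Fin (d + 1) → ℂ} (hk : k ∈ Strip (d + 1) (kapY (d + 1)))
    (μ : Fin (d + 1)) (hre : (k μ).re = -Real.pi) : S n a b (tr k μ) = S n a b k := by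
  obtain ⟨hκ1, hdκ⟩ := kappa_small (kapY_pos (d + 1)).le (kapY_le_rOf (d + 1))
  have hπ := Real.pi_pos
  have h0 : DeltaXi n 0 k ≠ 0 := by
    intro h
    have := re_DeltaXi_pos_of_edge n 0 le_rfl hκ1 hdκ (fun ν => (hk ν).2) μ (by rw [hre, abs_neg, abs_of_pos hπ])
    rw [h, Complex.zero_re] at this
    linarith
  have h1 : DeltaXi n 0 (tr k μ) ≠ 0 := by
    intro h
    have := re_DeltaXi_pos_of_edge n 0 le_rfl hκ1 hdκ (q := tr k μ)
      (fun ν => by rw [tr_im]; exact (hk ν).2) μ (by rw [tr_re_self, hre]; ring_nf; exact abs_of_pos hπ)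
    rw [h, Complex.zero_re] at this
    linarith
  rw [S_eq_honest n a b h1, S_eq_honest n a b h0, yInv_periodic_side n hk μ hre, tr_def, Fa_periodic, Fb_periodic]

/-! ## §4 The conditional END: an n-uniform bound gives strip regularity and the decay of the fine kernel -/

/-- [our object] **STRIP REGULARITY OF THE FINE-KERNEL SYMBOL FROM ITS n-UNIFORM BOUND**: if `‖S n a b k‖ ≤ M` on `Strip D κ_Y`, then
`StripRegular (S n a b) κ_Y M` (continuity and slice holomorphy from §2, sides from §3). -/
theorem stripRegular_S_of_bound (n : ℕ) [NeZero n] (a b : Fin (d + 1) → ℤ) {M : ℝ}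
    (hM : ∀ k ∈ Strip (d + 1) (kapY (d + 1)), ‖S n a b k‖ ≤ M) :
    StripRegular (d := d) (fun k : Fin (d + 1) → ℂ => S n a b k) (kapY (d + 1)) M := by
  have hκ0 := (kapY_pos (d + 1)).le
  refine ⟨fun k hk => (differentiableAt_S n a b hk).continuousAt.continuousWithinAt, ?_, ?_, hM⟩
  · intro i q hq z hz
    have hP : i.insertNth z (ofRealVec q) ∈ Strip (d + 1) (kapY (d + 1)) := insertNth_mem_Strip hκ0 i hq (openRect_subset_closedRect _ hz)
    exact ((differentiableAt_S n a b hP).comp z (differentiableAt_insertNth i _ z)).differentiableWithinAt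
  · intro i q hq y hy
    obtain ⟨hP, hre⟩ := insertNth_left_mem hκ0 i hq hy
    rw [← tr_insertNth_left]
    exact (S_periodic_side n a b hP i hre).symm

/-- [our object] **THE CONDITIONAL END OF ROW GAMMA-3 (zeroth B-jet)**: an n-uniform bound `‖S n a b‖ ≤ M` on the strip gives
`‖latticeKernel (S n a b) X‖ ≤ M·e^{−κ_Y‖X‖∞}` — i.e. `|(1−Π)(nX+a, nY+b)| ≤ M·n^{−D}·e^{−κ_Y|X−Y|}` in the reading above; the bound `M = CS(D)`
is the alias-sum estimate of `GAMMA3-C-DESIGN.md` §3 (AM–GM on the support of `l`). -/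
theorem norm_latticeKernel_S_le_of_bound (n : ℕ) [NeZero n] (a b : Fin (d + 1) → ℤ) {M : ℝ}
    (hM : ∀ k ∈ Strip (d + 1) (kapY (d + 1)), ‖S n a b k‖ ≤ M) (X : Fin (d + 1) → ℤ) :
    ‖latticeKernel (fun k : Fin (d + 1) → ℂ => S n a b k) X‖ ≤ M * Real.exp (-(kapY (d + 1) * supNorm X)) :=
  latticeKernel_decay (stripRegular_S_of_bound n a b hM) (kapY_pos (d + 1)).le X

end Summit.QuantumFields.BalabanUV.Beta.FP.SliceProjectorSymbol

end
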